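import Summits.QuantumFields.YangMills.Theorems.AtomicCalibrationRMirrorCalibrationKDefs
import Summits.QuantumFields.YangMills.Theorems.AtomicCalibrationRSlotShift
import Summits.QuantumFields.YangMills.Theorems.AtomicCalibrationRSmearedLeafModuloFloors
import HarnessLib

/-!
# B7K `stub_smearedIVDataK` of «MirrorCalibration» REV 4 (stmt-QuantumFields-28169) — PROVED:
# `SmearedIVInputK → InfiniteVolumeContinuum.HypercubicOSDataFromInfiniteVolume` (leaf 19868 BY NAME)

Planner seat `ym-idea-11` g17; landing kit file **K4 of 4** (= HOME `g17/rev4/mc_b7k.lean` §3, sha8 e07de6df; toolkit in K3, currency in K1).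

`smearedIVDataK_proof`: the admissible constants (`α`, `|C|`) feed the LANDED smeared engine `smeared_osData_modulo_floors` (✓p726311: every leaf
clause except NT/NG); the compact-witness floors pass to the odd-torus limit states for the SAME witnesses (`InfiniteVolume.tendsto_Q2 / tendsto_Q3`);
the dictionary `ofReal_q2State_eq_sum_tsum_tensor₂` / `ofReal_q3State_eq_sum_tsum` + the junction `tendsto_base_of_centre` (K3) per valid
orientation tuple give `(Q2State μ_k (a β_k) θv v : ℂ) → S₁ 2 (θv ⊗ v)` and `(Q3State …) → S₁ 3 T₃`; the endings are verbatim those of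
`InfiniteVolume.twoPointNontrivial_of_lowerBoundsTL` / `nonGaussian_of_lowerBoundsTL`.  `stub_smearedIVDataK := smearedIVDataK_proof`.

HONEST LABEL: soft analysis / calibration / bookkeeping on HYPOTHESES; nothing here proves NT, a β-uniform bound, the leaf 19868
unconditionally, any crux, rung or summit; nothing about Bałaban's RG or Clay is asserted; the Yang–Mills mass gap is NOT proved.
-/

set_option autoImplicit false

noncomputable section

open scoped BigOperators SchwartzMap
open MeasureTheory Filter Topology
open Literature.MathematicalPhysics.QuantumFieldTheory hiding ZdEdge
open Literature.MathematicalPhysics.QuantumLattice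
open Literature.MathematicalPhysics.AQFT
open Literature.Probability.LatticeModels (Site)
open Summit.QuantumFields.YangMills.Cruxes.OSLegsFromFemtoAndGap.DlrCollarTransfer (LowerBounds Q2 Q3 plane exists_abs_plane_le)
open Summit.QuantumFields.YangMills.Theorems.HypercubicLimit.Negative
  (tensor₂ tensor₂_apply isTensorOf_tensor₂ twoPointNontrivial_of_real isOffDiagonal_of_halfSpaces tsupport_thetaTest_neg)
open Summit.QuantumFields.YangMills.Theorems.OSLegsFromFemtoAndGap (isOffDiagonal_of_disjoint_three)
open Summit.QuantumFields.YangMills.Theorems.InfiniteVolume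
  (stateMomentStr abs_stateMomentStr_le summable_mul_of_bounded Q2State Q3State q2State_eq tendsto_Q2 tendsto_Q3
    ofReal_q2State_eq_sum_tsum_tensor₂ ofReal_q3State_eq_sum_tsum)
open Summit.QuantumFields.YangMills.Cruxes.AtomicCalibrationR.SmearedLeafModuloFloors (smeared_osData_modulo_floors)

namespace Summit.QuantumFields.YangMills.Cruxes.AtomicCalibrationR.MirrorCalibration

/-! ## §3 The proof of B7K -/

section Main

/-- Along the defining tori of an odd-torus limit state the physical size eventually exceeds any threshold. [folklore] -/
theorem eventually_size_ge {a : ℝ → ℝ} (hapos : ∀ β, 0 < a β) (β Λ : ℝ) {S : ℕ → ℕ} (hS : StrictMono S) :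
    ∀ᶠ k in atTop, Λ ≤ a β * (S k : ℕ) := by
  have ht : Tendsto (fun k => a β * ((S k : ℕ) : ℝ)) atTop atTop :=
    (tendsto_natCast_atTop_atTop.comp hS.tendsto_atTop).const_mul_atTop (hapos β)
  exact ht.eventually_ge_atTop Λ

/-- **B7K (PROOF).**  `SmearedIVInputK → HypercubicOSDataFromInfiniteVolume`. [folklore assembly on hypotheses] -/
theorem smearedIVDataK_proof : SmearedIVDataK := by
  intro hK G _ _ _ _ hG hcl
  letI : MeasurableSpace G := borel G
  haveI : BorelSpace G := ⟨rfl⟩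
  obtain ⟨r, a, c, N, α, C, γ, β₈, hapos, ha0, hLB, hc, hbd⟩ := hK G hG hcl
  -- admissible constants with `C ↦ |C|`
  have hc0 : ∀ n, 0 ≤ c n := fun n => (hc n).1
  have hα : 0 ≤ α := by
    have h := (hc 0).2
    simp only [pow_zero, mul_one, Nat.factorial_zero, Nat.cast_one, Real.one_rpow] at h
    exact (hc0 0).trans h
  have hcadm : ∀ n, c n ≤ α * |C| ^ n * (n.factorial : ℝ) ^ γ := fun n =>
    (hc n).2.trans (mul_le_mul_of_nonneg_right
      (mul_le_mul_of_nonneg_left ((le_abs_self _).trans_eq (abs_pow C n)) hα)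
      (Real.rpow_nonneg (Nat.cast_nonneg _) γ))
  -- the landed smeared engine: everything but NT / NG
  obtain ⟨β, μ, S₁, T, ⟨hβ, hμ, h0, h1, hS, hT⟩, hβ8, hprob, hN, hH, hLG, hW4, hRP, hSym, hTr⟩ :=
    smeared_osData_modulo_floors r a hapos ha0 c N β₈ hc0 hα (abs_nonneg C) hcadm hbd
  haveI : ∀ k, IsProbabilityMeasure (μ k) := hprob
  have hs : ∀ k, 0 < a (β k) := fun k => hapos (β k)
  have hs0 : Tendsto (fun k => a (β k)) atTop (𝓝 0) := ha0.comp hβ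
  -- the valid orientation tuples
  have hvalid : ∀ {n : ℕ} {Q : Fin n → Fin 4 × Fin 4},
      Q ∈ Fintype.piFinset (fun _ : Fin n => Finset.univ.filter (fun q : Fin 4 × Fin 4 => q.1 < q.2)) →
        ∀ i, (Q i).1 < (Q i).2 := by
    intro n Q hQ i
    have := Fintype.mem_piFinset.1 hQ i
    simpa using this
  -- base-point convergence for a test whose small slot shifts stay off-diagonal
  have hjunction : ∀ {n : ℕ} (hn : 2 ≤ n) (Q : Fin n → Fin 4 × Fin 4) (hQ : ∀ i, (Q i).1 < (Q i).2)
      (F : 𝓢((Fin n → EuclideanSpace ℝ (Fin 4)), ℂ)), IsOffDiagonal F →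
      (∀ᶠ k in atTop, IsOffDiagonal (SchwartzMap.compSubConstCLM ℂ (ctrOff (a (β k)) Q) F)) →
        Tendsto (fun k => ∑' x : Fin n → Site 4, ((stateMomentStr G r (μ k) n Q x : ℝ) : ℂ) *
          F (fun l => a (β k) • siteToE (x l))) atTop (𝓝 (T n Q F)) := by
    intro n hn Q hQ F hF hFk
    exact tendsto_base_of_centre r μ (fun k => a (β k)) hs hs0 Q
      (fun k F' hF' => hbd (β k) (hβ8 k) (μ k) (hμ k) n Q hn hQ F' hF') F hF (hT n hn Q hQ F hF) hFk
  refine ⟨r, a, β, μ, S₁, T, hapos, ha0, ⟨hβ, hμ, h0, h1, hS, hT⟩, hN, hH, hLG, hW4, hRP, hSym, hTr, ?_, ?_⟩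
  · -- NT: the two-point floor with the compact witness `v`
    obtain ⟨v, ε, β₅, Λ₅, hvc, hv, hε, hfl⟩ := hLB.1
    have hu := tsupport_thetaTest_neg hv
    -- the floor in every odd-torus limit state (same witness, same ε)
    have hflTL : ∀ β' : ℝ, β₅ ≤ β' → ∀ ν ∈ oddTorusLimitPoints r β', ε ≤ Q2State G r ν (a β') (thetaTest 4 v) v := by
      intro β' hβ' ν hν
      obtain ⟨S, hSm, hlim⟩ := hν
      haveI : IsProbabilityMeasure ν := hlim.1
      rw [q2State_eq]
      refine ge_of_tendsto (tendsto_Q2 r hSm hlim (hapos β') (thetaTest 4 v) v) ?_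
      filter_upwards [eventually_size_ge hapos β' Λ₅ hSm] with k hk
      exact hfl β' hβ' (S k) hk
    -- the shifted two-tensors are eventually off-diagonal
    set F2 : 𝓢((Fin (1 + 1) → EuclideanSpace ℝ (Fin 4)), ℂ) := tensor₂ (thetaTest 4 v) v with hF2
    have hF2od : IsOffDiagonal F2 := isOffDiagonal_of_halfSpaces hu hv (isTensorOf_tensor₂ _ _)
    obtain ⟨δ, hδ, hsep⟩ := exists_sep_two hvc hv
    have hshift : ∀ Q : Fin (1 + 1) → Fin 4 × Fin 4,
        ∀ᶠ k in atTop, IsOffDiagonal (SchwartzMap.compSubConstCLM ℂ (ctrOff (a (β k)) Q) F2) := by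
      intro Q
      filter_upwards [hs0.eventually (eventually_lt_nhds hδ)] with k hk
      exact isOffDiagonal_shift_of_isTensorOf (isTensorOf_tensor₂ (thetaTest 4 v) v) hsep _
        (fun l => (norm_ctrOff_le (hs k).le Q l).trans_lt hk)
    -- convergence of the complexified `Q2State` to `S₁ 2 (θv ⊗ v)`
    have hlim : Tendsto (fun k => ((Q2State G r (μ k) (a (β k)) (thetaTest 4 v) v : ℝ) : ℂ)) atTop
        (𝓝 (S₁ 2 F2)) := by
      rw [hS 2 le_rfl F2]
      have hrw : ∀ k, ((Q2State G r (μ k) (a (β k)) (thetaTest 4 v) v : ℝ) : ℂ) =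
          ∑ Q ∈ Fintype.piFinset (fun _ : Fin 2 => Finset.univ.filter (fun q : Fin 4 × Fin 4 => q.1 < q.2)),
            ∑' x : Fin 2 → Site 4, ((stateMomentStr G r (μ k) 2 Q x : ℝ) : ℂ) *
              F2 (fun l => a (β k) • siteToE (x l)) := fun k =>
        ofReal_q2State_eq_sum_tsum_tensor₂ r (μ k) (hs k) (thetaTest 4 v) v
      simp_rw [hrw]
      exact tendsto_finsetSum _ fun Q hQ => hjunction le_rfl Q (hvalid hQ) F2 hF2od (hshift Q)
    -- conclusion (verbatim the ending of `InfiniteVolume.twoPointNontrivial_of_lowerBoundsTL`)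
    refine twoPointNontrivial_of_real S₁.toLabelled () hu hv ?_
    simp only [SchwingerFamily.toLabelled_apply, h1, mul_zero]
    have hev : ∀ᶠ k in atTop, ε ≤ Q2State G r (μ k) (a (β k)) (thetaTest 4 v) v := by
      filter_upwards [hβ.eventually_ge_atTop β₅] with k hk
      exact hflTL _ hk _ (hμ k)
    have hre : Tendsto (fun k => (((Q2State G r (μ k) (a (β k)) (thetaTest 4 v) v : ℝ) : ℂ)).re) atTop
        (𝓝 (S₁ 2 F2).re) := (Complex.continuous_re.tendsto _).comp hlim
    have hge : ε ≤ (S₁ 2 F2).re :=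
      ge_of_tendsto hre (hev.mono fun k hk => by rw [Complex.ofReal_re]; exact hk)
    intro h0'
    have : (S₁ 2 F2).re = 0 := by
      rw [show S₁ 2 F2 = 0 from h0', Complex.zero_re]
    linarith
  · -- NG: the three-point floor with the compact witnesses `f, g, h`
    obtain ⟨f, g, h, ε, β₅, Λ₅, hfc, hgc, hhc, hfg, hgh, hfh, hε, hfl⟩ := hLB.2
    have hflTL : ∀ β' : ℝ, β₅ ≤ β' → ∀ ν ∈ oddTorusLimitPoints r β', ε ≤ |Q3State G r ν (a β') f g h| := by
      intro β' hβ' ν hν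
      obtain ⟨S, hSm, hlim⟩ := hν
      haveI : IsProbabilityMeasure ν := hlim.1
      refine ge_of_tendsto (tendsto_Q3 r hSm hlim (hapos β') f g h).abs ?_
      filter_upwards [eventually_size_ge hapos β' Λ₅ hSm] with k hk
      exact hfl β' hβ' (S k) hk
    set T3 : 𝓢((Fin 3 → EuclideanSpace ℝ (Fin 4)), ℂ) :=
      SchwartzMap.tensorFin 3 ![ofRealTest f, ofRealTest g, ofRealTest h] with hT3def
    have hT3 : IsTensorOf T3 ![ofRealTest f, ofRealTest g, ofRealTest h] := isTensorOf_tensorFin _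
    have hod : IsOffDiagonal T3 := isOffDiagonal_of_disjoint_three hfg hgh hfh hT3
    obtain ⟨δ, hδ, hsep⟩ := exists_sep_three hfc hgc hfg hgh hfh
    have hshift : ∀ Q : Fin 3 → Fin 4 × Fin 4,
        ∀ᶠ k in atTop, IsOffDiagonal (SchwartzMap.compSubConstCLM ℂ (ctrOff (a (β k)) Q) T3) := by
      intro Q
      filter_upwards [hs0.eventually (eventually_lt_nhds hδ)] with k hk
      exact isOffDiagonal_shift_of_isTensorOf hT3 hsep _ (fun l => (norm_ctrOff_le (hs k).le Q l).trans_lt hk)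
    have hlim : Tendsto (fun k => ((Q3State G r (μ k) (a (β k)) f g h : ℝ) : ℂ)) atTop (𝓝 (S₁ 3 T3)) := by
      rw [hS 3 (by norm_num) T3]
      have hrw : ∀ k, ((Q3State G r (μ k) (a (β k)) f g h : ℝ) : ℂ) =
          ∑ Q ∈ Fintype.piFinset (fun _ : Fin 3 => Finset.univ.filter (fun q : Fin 4 × Fin 4 => q.1 < q.2)),
            ∑' x : Fin 3 → Site 4, ((stateMomentStr G r (μ k) 3 Q x : ℝ) : ℂ) *
              T3 (fun l => a (β k) • siteToE (x l)) := fun k =>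
        ofReal_q3State_eq_sum_tsum r (μ k) (hs k) f g h T3 hT3
      simp_rw [hrw]
      exact tendsto_finsetSum _ fun Q hQ => hjunction (by norm_num) Q (hvalid hQ) T3 hod (hshift Q)
    -- conclusion (verbatim the ending of `InfiniteVolume.nonGaussian_of_lowerBoundsTL`)
    refine ⟨ofRealTest f, ofRealTest g, ofRealTest h, T3,
      SchwartzMap.tensorFin 2 ![ofRealTest g, ofRealTest h], SchwartzMap.tensorFin 2 ![ofRealTest f, ofRealTest h],
      SchwartzMap.tensorFin 2 ![ofRealTest f, ofRealTest g], SchwartzMap.tensorFin 1 ![ofRealTest f],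
      SchwartzMap.tensorFin 1 ![ofRealTest g], SchwartzMap.tensorFin 1 ![ofRealTest h], hT3, hod,
      isTensorOf_tensorFin _, isTensorOf_tensorFin _, isTensorOf_tensorFin _, isTensorOf_tensorFin _,
      isTensorOf_tensorFin _, isTensorOf_tensorFin _, ?_⟩
    simp only [SchwingerFamily.toLabelled_apply, h1, zero_mul, sub_zero, mul_zero, add_zero]
    have hev : ∀ᶠ k in atTop, ε ≤ |Q3State G r (μ k) (a (β k)) f g h| := by
      filter_upwards [hβ.eventually_ge_atTop β₅] with k hk
      exact hflTL _ hk _ (hμ k)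
    have hnorm : Tendsto (fun k => ‖((Q3State G r (μ k) (a (β k)) f g h : ℝ) : ℂ)‖) atTop (𝓝 ‖S₁ 3 T3‖) :=
      (continuous_norm.tendsto _).comp hlim
    have hge : ε ≤ ‖S₁ 3 T3‖ :=
      ge_of_tendsto hnorm (hev.mono fun k hk => by rw [Complex.norm_real, Real.norm_eq_abs]; exact hk)
    intro h0'
    rw [h0', norm_zero] at hge
    linarith

/-- **B7K `stub_smearedIVDataK`** — the registered stub of rev 4, now a theorem. -/
theorem stub_smearedIVDataK : SmearedIVDataK := smearedIVDataK_proof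

end Main

end Summit.QuantumFields.YangMills.Cruxes.AtomicCalibrationR.MirrorCalibration

end
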